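import Literature.Analysis.FluidPDE.TaoCascadeOperator
import Literature.Analysis.FunctionSpaces.PlancherelL1L2
import HarnessLib

/-!
# Tao's averaged Navier–Stokes setting: the slot operators `m(D)`, `Rot_R`, `Dil_λ` and `𝓕`

T. Tao, *Finite time blowup for an averaged three-dimensional Navier–Stokes equation*,
J. Amer. Math. Soc. **29** (2016), 601–674 = arXiv:1402.0290v3 (held as `paper:arxiv-1402.0290`),
§1.1, p. 6: "note that the Fourier transform also rotates by the same law,
`\widehat{Rot_R(u)}(ξ) = R û(R⁻¹ξ)`", the dilations (1.11) `Dil_λ u(x) = λ^{3/2} u(λx)` and the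
Fourier multipliers `\widehat{m(D)u}(ξ) = m(ξ) û(ξ)`.

This is the first support file of the discharge of the named fact
`Literature.Analysis.FluidPDE.Tao2016.complexAverage_linear_right`
(`TaoAveragedComplexAverage.lean`): the `ℂ`-linearity in `w` of a complex average (3.4) of the
Euler form, which rests on the absolute convergence of (1.13)/(3.4) (Tao, p. 7). Everything
here concerns the three operators of which a slot `m(D) ∘ Rot_R ∘ Dil_λ` of (1.12)/(3.4) is
composed (accepted definitions `fourierMultiplier`, `rot`, `dil` of `TaoAveragedSobolev.lean`,
on `L2C = L²(ℝ³; ℂ³)`):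

* `fourierMultiplier_add/_smul`, `rot_add/_smul`, `dil_add/_smul` — they are `ℂ`-linear;
* `coeFn_rot`, `norm_rot`, `norm_dil` — a.e. representatives and `‖Rot_R u‖ = ‖u‖`,
  `‖Dil_λ u‖ = ‖u‖` (`λ > 0`);
* `complexifyCLM_apply`, `norm_complexifyCLM` — the complexified rotation matrix acts
  coordinatewise and isometrically on `ℂ³`;
* `fourier_rot`, `fourier_dil` — **`𝓕 ∘ Rot_R = Rot_R ∘ 𝓕` and `𝓕 ∘ Dil_λ = Dil_{1/λ} ∘ 𝓕` on
  `L²`** (Tao p. 6), proved by Schwartz density from Mathlib's `Real.fourier_comp_linearIsometry`,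
  the tree's `fourier_comp_smul` and `fourier_toLp_ae_eq_fourierIntegral` (`L¹ ∩ L²` agreement);
* `fourierFn_rot`, `fourierFn_dil` — the resulting a.e. formulas for the representative
  `fourierFn`.

## References

* T. Tao, J. Amer. Math. Soc. 29 (2016), 601–674, arXiv:1402.0290v3, §1.1 p. 6 ((1.10)–(1.12)).
  Key `Tao2016AveragedNS`.
-/

noncomputable section

open MeasureTheory Set Filter Topology FourierTransform Complex
open scoped ENNReal NNReal SchwartzMap ComplexConjugate

namespace Literature.Analysis.FluidPDE.Tao2016

section Slots

variable (m : Lp ℂ ∞ (volume : Measure (EuclideanSpace ℝ (Fin 3))))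
  (R : EuclideanSpace ℝ (Fin 3) ≃ₗᵢ[ℝ] EuclideanSpace ℝ (Fin 3)) (u v : L2C)

/-! ### Linearity of `m(D)`, `Rot_R`, `Dil_λ` -/

/-- `m(D)` is additive on `L²`. [folklore] -/
theorem fourierMultiplier_add :
    fourierMultiplier m (u + v) = fourierMultiplier m u + fourierMultiplier m v := by
  unfold fourierMultiplier
  rw [FourierTransform.fourier_add, Lp.add_smul, FourierTransform.fourierInv_add]

/-- `m(D)` commutes with complex scalars. [folklore] -/
theorem fourierMultiplier_smul (c : ℂ) : fourierMultiplier m (c • u) = c • fourierMultiplier m u := by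
  unfold fourierMultiplier
  rw [FourierTransform.fourier_smul, ← Lp.smul_comm c m (𝓕 u : L2C),
    FourierTransform.fourierInv_smul]

/-- `Rot_R` is additive on `L²`. [folklore] -/
theorem rot_add : rot R (u + v) = rot R u + rot R v := by
  simp only [rot, map_add]
  exact map_add (ContinuousLinearMap.compLpₗ 2 volume
    (complexifyCLM R.toLinearIsometry.toContinuousLinearMap)) _ _

/-- `Rot_R` commutes with complex scalars. [folklore] -/
theorem rot_smul (c : ℂ) : rot R (c • u) = c • rot R u := by
  simp only [rot]
  rw [show Lp.compMeasurePreserving R.symm R.symm.measurePreserving (c • u) =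
      c • Lp.compMeasurePreserving R.symm R.symm.measurePreserving u from
    (Lp.compMeasurePreservingₗ ℂ (R.symm : EuclideanSpace ℝ (Fin 3) → EuclideanSpace ℝ (Fin 3))
      R.symm.measurePreserving).map_smul c u]
  exact (ContinuousLinearMap.compLpₗ 2 volume
    (complexifyCLM R.toLinearIsometry.toContinuousLinearMap)).map_smul c _

/-- `Rot_R` is continuous on `L²`. [folklore] -/
theorem continuous_rot : Continuous (rot R) :=
  (ContinuousLinearMap.continuous (ContinuousLinearMap.compLpL 2 volume
    (complexifyCLM R.toLinearIsometry.toContinuousLinearMap))).comp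
    (Lp.isometry_compMeasurePreserving R.symm.measurePreserving).continuous

/-- A representative of `Rot_R u`: `x ↦ R u(R⁻¹ x)` (complexified `R` on the values). [cite: Tao2016AveragedNS, §1.1 p. 6] -/
theorem coeFn_rot : ⇑(rot R u) =ᵐ[volume] fun x =>
    complexifyCLM R.toLinearIsometry.toContinuousLinearMap (u (R.symm x)) := by
  unfold rot
  filter_upwards [ContinuousLinearMap.coeFn_compLp
      (complexifyCLM R.toLinearIsometry.toContinuousLinearMap)
      (Lp.compMeasurePreserving _ R.symm.measurePreserving u),
    Lp.coeFn_compMeasurePreserving u R.symm.measurePreserving] with x hx h2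
  rw [hx, h2]
  rfl

/-- `Dil_c` is additive on `L²`. [folklore] -/
theorem dil_add (c : ℝ) : dil c (u + v) = dil c u + dil c v := by
  by_cases hc : c = 0
  · simp [dil, hc]
  apply Lp.ext
  filter_upwards [coeFn_dil hc (u + v), Lp.coeFn_add (dil c u) (dil c v), coeFn_dil hc u,
    coeFn_dil hc v, (Measure.quasiMeasurePreserving_smul volume hc).ae_eq (Lp.coeFn_add u v)]
    with x h1 h2 h3 h4 h5
  rw [h1, h2, Pi.add_apply, h3, h4, ← smul_add]
  exact congrArg _ h5

/-- `Dil_c` commutes with complex scalars. [folklore] -/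
theorem dil_smul (c : ℝ) (a : ℂ) : dil c (a • u) = a • dil c u := by
  by_cases hc : c = 0
  · simp [dil, hc]
  apply Lp.ext
  filter_upwards [coeFn_dil hc (a • u), Lp.coeFn_smul a (dil c u), coeFn_dil hc u,
    (Measure.quasiMeasurePreserving_smul volume hc).ae_eq (Lp.coeFn_smul a u)] with x h1 h2 h3 h4
  rw [h1, h2, Pi.smul_apply, h3, smul_comm]
  exact congrArg _ h4

/-- `Dil_c (u - v) = Dil_c u - Dil_c v`. [folklore] -/
theorem dil_sub (c : ℝ) : dil c (u - v) = dil c u - dil c v := by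
  rw [sub_eq_add_neg, dil_add, ← neg_one_smul ℂ v, dil_smul, neg_one_smul, ← sub_eq_add_neg]

/-! ### Norms: `Rot_R` and `Dil_λ` (`λ > 0`) are isometries of `L²` -/

/-- The coordinates of the complexified matrix action: `(T_ℂ V)_i = ∑ⱼ T_{ij} V_j` with
`T_{ij} = (T e_j)_i`. [folklore] -/
theorem complexifyCLM_apply (T : EuclideanSpace ℝ (Fin 3) →L[ℝ] EuclideanSpace ℝ (Fin 3))
    (V : EuclideanSpace ℂ (Fin 3)) (i : Fin 3) :
    complexifyCLM T V i = ∑ j, ((T (EuclideanSpace.single j (1 : ℝ)) i : ℝ) : ℂ) * V j := by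
  set M : Matrix (Fin 3) (Fin 3) ℂ := (LinearMap.toMatrix (EuclideanSpace.basisFun (Fin 3) ℝ).toBasis
    (EuclideanSpace.basisFun (Fin 3) ℝ).toBasis
    (T : EuclideanSpace ℝ (Fin 3) →ₗ[ℝ] EuclideanSpace ℝ (Fin 3))).map (algebraMap ℝ ℂ) with hM
  unfold complexifyCLM
  rw [← hM, show (Matrix.toEuclideanCLM (n := Fin 3) (𝕜 := ℂ) M V) i =
    (WithLp.ofLp (Matrix.toEuclideanCLM (n := Fin 3) (𝕜 := ℂ) M V)) i from rfl,
    Matrix.ofLp_toEuclideanCLM]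
  simp only [hM, Matrix.mulVec, dotProduct, Matrix.map_apply, LinearMap.toMatrix_apply,
    OrthonormalBasis.coe_toBasis_repr_apply, EuclideanSpace.basisFun_repr,
    OrthonormalBasis.coe_toBasis, EuclideanSpace.basisFun_apply, ContinuousLinearMap.coe_coe,
    Complex.coe_algebraMap]

/-- The complexification of a real vector commutes with `T ↦ T_ℂ`:
`T_ℂ (x + 0i) = T x + 0i`. [folklore] -/
theorem complexifyCLM_complexify (T : EuclideanSpace ℝ (Fin 3) →L[ℝ] EuclideanSpace ℝ (Fin 3))
    (x : EuclideanSpace ℝ (Fin 3)) :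
    complexifyCLM T (FunctionSpaces.EuclideanSpace.complexify x) =
      FunctionSpaces.EuclideanSpace.complexify (T x) := by
  have hx : x = ∑ j, x j • EuclideanSpace.single j (1 : ℝ) := by
    simpa using ((EuclideanSpace.basisFun (Fin 3) ℝ).sum_repr x).symm
  ext i
  rw [complexifyCLM_apply, FunctionSpaces.EuclideanSpace.complexify_apply]
  conv_rhs => rw [hx]
  simp only [map_sum, map_smul, FunctionSpaces.EuclideanSpace.complexify_apply]
  rw [show (∑ j, x j • T (EuclideanSpace.single j (1 : ℝ))) i =
      ∑ j, (x j • T (EuclideanSpace.single j (1 : ℝ))) i from by simp]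
  push_cast
  refine Finset.sum_congr rfl fun j _ => ?_
  rw [PiLp.smul_apply, smul_eq_mul, Complex.ofReal_mul, mul_comm]

/-- `‖x + iy‖² = ‖x‖² + ‖y‖²` for real vectors `x, y ∈ ℝ³` complexified into `ℂ³`. [folklore] -/
theorem norm_sq_complexify_add_I_smul (x y : EuclideanSpace ℝ (Fin 3)) :
    ‖FunctionSpaces.EuclideanSpace.complexify x +
        (I : ℂ) • FunctionSpaces.EuclideanSpace.complexify y‖ ^ 2 = ‖x‖ ^ 2 + ‖y‖ ^ 2 := by
  rw [EuclideanSpace.norm_sq_eq, EuclideanSpace.norm_sq_eq, EuclideanSpace.norm_sq_eq,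
    ← Finset.sum_add_distrib]
  refine Finset.sum_congr rfl fun i _ => ?_
  rw [PiLp.add_apply, PiLp.smul_apply, FunctionSpaces.EuclideanSpace.complexify_apply,
    FunctionSpaces.EuclideanSpace.complexify_apply, Complex.sq_norm, Complex.normSq_apply,
    Real.norm_eq_abs, Real.norm_eq_abs, sq_abs, sq_abs]
  simp
  ring

/-- Real and imaginary parts: every `V ∈ ℂ³` is `x + iy` with `x = Re V`, `y = Im V ∈ ℝ³`. [folklore] -/
theorem complexify_re_add_I_smul_complexify_im (V : EuclideanSpace ℂ (Fin 3)) :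
    FunctionSpaces.EuclideanSpace.complexify (WithLp.toLp 2 fun j => (V j).re) +
      (I : ℂ) • FunctionSpaces.EuclideanSpace.complexify (WithLp.toLp 2 fun j => (V j).im) = V := by
  ext j
  rw [PiLp.add_apply, PiLp.smul_apply, FunctionSpaces.EuclideanSpace.complexify_apply,
    FunctionSpaces.EuclideanSpace.complexify_apply, PiLp.toLp_apply, PiLp.toLp_apply, smul_eq_mul,
    mul_comm, Complex.re_add_im]

/-- **The complexified rotation is an isometry of `ℂ³`**: `‖R_ℂ V‖ = ‖V‖` for a linear isometry
`R` of `ℝ³` (`R_ℂ(x + iy) = Rx + iRy`). [folklore] -/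
theorem norm_complexifyCLM (V : EuclideanSpace ℂ (Fin 3)) :
    ‖complexifyCLM R.toLinearIsometry.toContinuousLinearMap V‖ = ‖V‖ := by
  obtain ⟨x, y, rfl⟩ : ∃ x y : EuclideanSpace ℝ (Fin 3),
      V = FunctionSpaces.EuclideanSpace.complexify x +
        (I : ℂ) • FunctionSpaces.EuclideanSpace.complexify y :=
    ⟨_, _, (complexify_re_add_I_smul_complexify_im V).symm⟩
  rw [← sq_eq_sq₀ (norm_nonneg _) (norm_nonneg _), map_add, map_smul, complexifyCLM_complexify,
    complexifyCLM_complexify, norm_sq_complexify_add_I_smul, norm_sq_complexify_add_I_smul]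
  simp only [LinearIsometry.coe_toContinuousLinearMap, LinearIsometryEquiv.coe_toLinearIsometry,
    LinearIsometryEquiv.norm_map]

/-- **`Rot_R` is an isometry of `L²`**: `‖Rot_R u‖ = ‖u‖` (Tao, p. 6: the rotation operators
are uniformly bounded). [cite: Tao2016AveragedNS, §1.1 p. 6] -/
theorem norm_rot : ‖rot R u‖ = ‖u‖ := by
  rw [Lp.norm_def, Lp.norm_def, eLpNorm_congr_ae (coeFn_rot R u),
    eLpNorm_congr_norm_ae (Eventually.of_forall fun x => norm_complexifyCLM R _)]
  exact congrArg ENNReal.toReal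
    (eLpNorm_comp_measurePreserving (Lp.aestronglyMeasurable u) R.symm.measurePreserving)

/-- Change of variables for the `L²` norm under `x ↦ c x`:
`‖f(c ·)‖_{L²} = |c³|^{-1/2} ‖f‖_{L²}`. [folklore] -/
theorem eLpNorm_comp_smul {c : ℝ} (hc : c ≠ 0)
    (f : EuclideanSpace ℝ (Fin 3) → EuclideanSpace ℂ (Fin 3)) :
    eLpNorm (fun x => f (c • x)) 2 volume =
      ENNReal.ofReal (|c ^ 3|⁻¹) ^ (1 / 2 : ℝ) * eLpNorm f 2 volume := by
  have hemb : MeasurableEmbedding (fun x : EuclideanSpace ℝ (Fin 3) => c • x) :=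
    (Homeomorph.smulOfNeZero c hc).measurableEmbedding
  rw [show (fun x => f (c • x)) = f ∘ (fun x : EuclideanSpace ℝ (Fin 3) => c • x) from rfl,
    ← hemb.eLpNorm_map_measure, Measure.map_addHaar_smul volume hc,
    eLpNorm_smul_measure_of_ne_top ENNReal.ofNat_ne_top, smul_eq_mul, finrank_euclideanSpace,
    Fintype.card_fin, abs_inv]
  norm_num

/-- `c^{3/2} |c³|^{-1/2} = 1` for `c > 0`: the normalisation making `Dil_c` unitary. [folklore] -/
theorem rpow_three_halves_mul_toReal (c : ℝ) (hc : 0 < c) :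
    c ^ (3 / 2 : ℝ) * (ENNReal.ofReal (|c ^ 3|⁻¹) ^ (1 / 2 : ℝ)).toReal = 1 := by
  have h : ((c ^ 3)⁻¹) ^ (1 / 2 : ℝ) = (c ^ (3 / 2 : ℝ))⁻¹ := by
    rw [Real.inv_rpow (pow_nonneg hc.le 3), ← Real.rpow_natCast c 3, ← Real.rpow_mul hc.le]
    norm_num
  rw [← ENNReal.toReal_rpow, ENNReal.toReal_ofReal (by positivity), abs_of_pos (pow_pos hc 3), h,
    mul_inv_cancel₀ (Real.rpow_pos_of_pos hc _).ne']

/-- **`Dil_λ` is an isometry of `L²`** for `λ > 0`: `‖Dil_λ u‖ = ‖u‖` (the exponent `3/2` in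
(1.11)). [cite: Tao2016AveragedNS, (1.11)] -/
theorem norm_dil {c : ℝ} (hc : 0 < c) : ‖dil c u‖ = ‖u‖ := by
  unfold dil
  rw [dif_neg hc.ne', norm_smul, Lp.norm_toLp, eLpNorm_comp_smul hc.ne', ENNReal.toReal_mul,
    ← Lp.norm_def, Complex.norm_real, Real.norm_eq_abs, abs_of_pos (Real.rpow_pos_of_pos hc _),
    ← mul_assoc, rpow_three_halves_mul_toReal c hc, one_mul]

/-- `Dil_λ` (`λ > 0`) is continuous on `L²`. [folklore] -/
theorem continuous_dil {c : ℝ} (hc : 0 < c) : Continuous (dil c) :=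
  AddMonoidHomClass.continuous_of_bound (AddMonoidHom.mk' (dil c) (dil_add · · c)) 1 fun u => by
    rw [AddMonoidHom.mk'_apply, norm_dil u hc, one_mul]

/-! ### The Fourier transform commutes with rotations and intertwines dilations -/

/-- Schwartz density: two continuous maps on `L²(ℝ³; ℂ³)` that agree on (the classes of)
Schwartz fields agree. [folklore] -/
theorem eq_of_forall_schwartz {S T : L2C → L2C} (hS : Continuous S) (hT : Continuous T)
    (h : ∀ φ : 𝓢(EuclideanSpace ℝ (Fin 3), EuclideanSpace ℂ (Fin 3)), S (φ.toLp 2) = T (φ.toLp 2)) :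
    S = T :=
  DenseRange.equalizer
    (SchwartzMap.denseRange_toLpCLM (F := EuclideanSpace ℂ (Fin 3)) (p := 2)
      (μ := (volume : Measure (EuclideanSpace ℝ (Fin 3)))) ENNReal.ofNat_ne_top)
    hS hT (funext fun φ => h φ)

/-- The Fourier integral commutes with the complexified rotation of the values and the rotation
of the argument: `𝓕(R_ℂ ∘ φ ∘ R⁻¹)(ξ) = R_ℂ (𝓕φ)(R⁻¹ξ)` (Tao, p. 6). [cite: Tao2016AveragedNS, §1.1 p. 6] -/
theorem fourierIntegral_rot {φ : EuclideanSpace ℝ (Fin 3) → EuclideanSpace ℂ (Fin 3)}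
    (hφ : Integrable φ) (ξ : EuclideanSpace ℝ (Fin 3)) :
    𝓕 (fun x => complexifyCLM R.toLinearIsometry.toContinuousLinearMap (φ (R.symm x))) ξ =
      complexifyCLM R.toLinearIsometry.toContinuousLinearMap (𝓕 φ (R.symm ξ)) := by
  have hint : Integrable (φ ∘ R.symm) := R.symm.measurePreserving.integrable_comp_of_integrable hφ
  rw [Real.fourier_eq, ← Real.fourier_comp_linearIsometry R.symm φ ξ, Real.fourier_eq,
    ← ContinuousLinearMap.integral_comp_comm _ ((Real.fourierIntegral_convergent_iff ξ).2 hint)]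
  refine integral_congr_ae (Eventually.of_forall fun v => ?_)
  simp only [Function.comp_apply, Circle.smul_def, map_smul]

/-- **The Fourier transform commutes with rotations on `L²`**: `𝓕 (Rot_R u) = Rot_R (𝓕 u)`,
i.e. `\widehat{Rot_R u}(ξ) = R û(R⁻¹ξ)` (Tao 2016, p. 6), for Mathlib's `L²` Fourier transform;
by Schwartz density from the Fourier-integral identity. [cite: Tao2016AveragedNS, §1.1 p. 6] -/
theorem fourier_rot : (𝓕 (rot R u) : L2C) = rot R (𝓕 u : L2C) := by
  suffices h : (fun u : L2C => (𝓕 (rot R u) : L2C)) = fun u => rot R (𝓕 u : L2C) from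
    congrFun h u
  refine eq_of_forall_schwartz (continuous_fourier.comp (continuous_rot R))
    ((continuous_rot R).comp continuous_fourier) fun φ => ?_
  set L := complexifyCLM R.toLinearIsometry.toContinuousLinearMap with hL
  set g : EuclideanSpace ℝ (Fin 3) → EuclideanSpace ℂ (Fin 3) := fun x => L (φ (R.symm x)) with hg
  have hg1 : Integrable g :=
    ContinuousLinearMap.integrable_comp L
      (R.symm.measurePreserving.integrable_comp_of_integrable φ.integrable)
  have hg2 : MemLp g 2 (volume : Measure (EuclideanSpace ℝ (Fin 3))) :=
    ContinuousLinearMap.comp_memLp' L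
      ((φ.memLp 2 (volume : Measure (EuclideanSpace ℝ (Fin 3)))).comp_measurePreserving
        R.symm.measurePreserving)
  have hrot : rot R (φ.toLp 2) = hg2.toLp g := by
    apply Lp.ext
    filter_upwards [coeFn_rot R (φ.toLp 2), hg2.coeFn_toLp,
      R.symm.measurePreserving.quasiMeasurePreserving.ae_eq (φ.coeFn_toLp 2)] with x h1 h2 h3
    simp only [Function.comp_apply] at h3
    rw [h1, h2, h3]
  rw [hrot, SchwartzMap.toLp_fourier_eq]
  apply Lp.ext
  filter_upwards [FunctionSpaces.fourier_toLp_ae_eq_fourierIntegral hg1 hg2,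
    coeFn_rot R ((𝓕 φ).toLp 2),
    R.symm.measurePreserving.quasiMeasurePreserving.ae_eq ((𝓕 φ).coeFn_toLp 2)] with ξ h1 h2 h3
  simp only [Function.comp_apply] at h3
  rw [h1, h2, h3, hg, fourierIntegral_rot R φ.integrable ξ, SchwartzMap.fourier_coe]

/-- `c^{3/2} |c³|⁻¹ = (c⁻¹)^{3/2}` for `c > 0`: the Jacobian bookkeeping behind
`𝓕 ∘ Dil_λ = Dil_{1/λ} ∘ 𝓕`. [folklore] -/
theorem rpow_three_halves_mul_abs_inv_cube {c : ℝ} (hc : 0 < c) :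
    c ^ (3 / 2 : ℝ) * |(c ^ 3)⁻¹| = c⁻¹ ^ (3 / 2 : ℝ) := by
  have h3 : c ^ (3 : ℕ) = c ^ (3 / 2 : ℝ) * c ^ (3 / 2 : ℝ) := by
    rw [← Real.rpow_add hc, ← Real.rpow_natCast]
    norm_num
  rw [abs_of_pos (inv_pos.2 (pow_pos hc 3)), Real.inv_rpow hc.le, h3, mul_inv, ← mul_assoc,
    mul_inv_cancel₀ (Real.rpow_pos_of_pos hc _).ne', one_mul]

/-- The Fourier integral of a dilated field: `𝓕(c^{3/2} φ(c ·))(ξ) = c^{-3/2} (𝓕φ)(ξ/c)` for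
`c > 0` (change of variables; the tree's `fourier_comp_smul`). [cite: Tao2016AveragedNS, (1.11)] -/
theorem fourierIntegral_dil {c : ℝ} (hc : 0 < c)
    (φ : EuclideanSpace ℝ (Fin 3) → EuclideanSpace ℂ (Fin 3)) (ξ : EuclideanSpace ℝ (Fin 3)) :
    𝓕 (fun x => (((c ^ (3 / 2 : ℝ) : ℝ)) : ℂ) • φ (c • x)) ξ =
      (((c⁻¹ ^ (3 / 2 : ℝ) : ℝ)) : ℂ) • 𝓕 φ (c⁻¹ • ξ) := by
  rw [show (fun x => (((c ^ (3 / 2 : ℝ) : ℝ)) : ℂ) • φ (c • x)) =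
      (((c ^ (3 / 2 : ℝ) : ℝ)) : ℂ) • fun x => φ (c • x) from rfl,
    show 𝓕 ((((c ^ (3 / 2 : ℝ) : ℝ)) : ℂ) • fun x => φ (c • x)) =
      (((c ^ (3 / 2 : ℝ) : ℝ)) : ℂ) • 𝓕 (fun x => φ (c • x)) from
      VectorFourier.fourierIntegral_const_smul _ _ _ _ _,
    Pi.smul_apply, FunctionSpaces.fourier_comp_smul _ hc.ne' ξ, finrank_euclideanSpace,
    Fintype.card_fin, ← Complex.coe_smul, smul_smul, ← Complex.ofReal_mul,
    rpow_three_halves_mul_abs_inv_cube hc]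

/-- **The Fourier transform intertwines dilations on `L²`**: `𝓕 (Dil_λ u) = Dil_{1/λ} (𝓕 u)` for
`λ > 0`, i.e. `\widehat{Dil_λ u}(ξ) = λ^{-3/2} û(ξ/λ)` (Tao 2016, (1.11) and p. 6), for Mathlib's
`L²` Fourier transform; by Schwartz density. [cite: Tao2016AveragedNS, (1.11)] -/
theorem fourier_dil {c : ℝ} (hc : 0 < c) : (𝓕 (dil c u) : L2C) = dil c⁻¹ (𝓕 u : L2C) := by
  suffices h : (fun u : L2C => (𝓕 (dil c u) : L2C)) = fun u => dil c⁻¹ (𝓕 u : L2C) from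
    congrFun h u
  refine eq_of_forall_schwartz (continuous_fourier.comp (continuous_dil hc))
    ((continuous_dil (inv_pos.2 hc)).comp continuous_fourier) fun φ => ?_
  set g : EuclideanSpace ℝ (Fin 3) → EuclideanSpace ℂ (Fin 3) :=
    fun x => (((c ^ (3 / 2 : ℝ) : ℝ)) : ℂ) • φ (c • x) with hg
  have hg1 : Integrable g := by
    rw [hg]
    exact ((φ.integrable (μ := (volume : Measure (EuclideanSpace ℝ (Fin 3))))).comp_smul
      hc.ne').smul (((c ^ (3 / 2 : ℝ) : ℝ)) : ℂ)
  have h0 : MemLp (fun x => φ (c • x)) 2 (volume : Measure (EuclideanSpace ℝ (Fin 3))) := by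
    refine MemLp.comp_of_map (g := ⇑φ) ?_ (measurable_const_smul c).aemeasurable
    rw [Measure.map_addHaar_smul volume hc.ne']
    exact (φ.memLp 2 (volume : Measure (EuclideanSpace ℝ (Fin 3)))).smul_measure
      ENNReal.ofReal_ne_top
  have hg2 : MemLp g 2 (volume : Measure (EuclideanSpace ℝ (Fin 3))) := by
    rw [hg]
    exact h0.const_smul (((c ^ (3 / 2 : ℝ) : ℝ)) : ℂ)
  have hdil : dil c (φ.toLp 2) = hg2.toLp g := by
    apply Lp.ext
    filter_upwards [coeFn_dil hc.ne' (φ.toLp 2), hg2.coeFn_toLp,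
      (Measure.quasiMeasurePreserving_smul volume hc.ne').ae_eq (φ.coeFn_toLp 2)]
      with x h1 h2 h3
    simp only [Function.comp_apply] at h3
    rw [h1, h2, h3]
  rw [hdil, SchwartzMap.toLp_fourier_eq]
  apply Lp.ext
  filter_upwards [FunctionSpaces.fourier_toLp_ae_eq_fourierIntegral hg1 hg2,
    coeFn_dil (inv_pos.2 hc).ne' ((𝓕 φ).toLp 2),
    (Measure.quasiMeasurePreserving_smul volume (inv_pos.2 hc).ne').ae_eq
      ((𝓕 φ).coeFn_toLp 2)] with ξ h1 h2 h3
  simp only [Function.comp_apply] at h3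
  rw [h1, h2, h3, hg, fourierIntegral_dil hc _ ξ, SchwartzMap.fourier_coe]

/-! ### The Fourier representatives of `Rot_R u`, `Dil_λ u` -/

/-- `\widehat{Rot_R u}(ξ) = R_ℂ û(R⁻¹ξ)` for a.e. `ξ` (Tao 2016, p. 6). [cite: Tao2016AveragedNS, §1.1 p. 6] -/
theorem fourierFn_rot : fourierFn (rot R u) =ᵐ[volume] fun ξ =>
    complexifyCLM R.toLinearIsometry.toContinuousLinearMap (fourierFn u (R.symm ξ)) := by
  unfold fourierFn
  rw [fourier_rot]
  exact coeFn_rot R _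

/-- `\widehat{Dil_λ u}(ξ) = λ^{-3/2} û(ξ/λ)` for a.e. `ξ`, `λ > 0` (Tao 2016, (1.11), p. 6). [cite: Tao2016AveragedNS, (1.11)] -/
theorem fourierFn_dil {c : ℝ} (hc : 0 < c) : fourierFn (dil c u) =ᵐ[volume] fun ξ =>
    (((c⁻¹ ^ (3 / 2 : ℝ) : ℝ)) : ℂ) • fourierFn u (c⁻¹ • ξ) := by
  unfold fourierFn
  rw [fourier_dil u hc]
  exact coeFn_dil (inv_pos.2 hc).ne' _

end Slots

end Literature.Analysis.FluidPDE.Tao2016
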